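import Summits.SmoothPoincare4.SmoothPoincare4.Theorems.EntropyRungConicalGapRicciNormSqIntegrable
import HarnessLib

/-!
# Helper `helper_secondOrderTestIdentity` of line `Sketch`
(crux `EntropyRung.ConicalGap`, stmt-SmoothPoincare4-16589; lead seat c5, cycle 5, localisation)

**The second-order (Ricci) identity in general test-function form**, `n = 4`: on a complete
connected normalised gradient shrinking Ricci soliton `(M⁴, g, f)` (`Ric + Hess f = g/2`,
`R + |∇f|² = f`, closed `g`-balls compact), for every `η ∈ C¹(ℝ)` with `η`, `η′` bounded and every
`τ > 0`, writing `v = e^{-f/τ}` and all integrals w.r.t. `dV`,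

  `∫ v [ (η′(f) + (1 − τ⁻¹) η(f)) g⁻¹(dR, df) + η(f) (R − 2|Ric|²) ] = 0`,

the integrand being integrable. At `η ≡ 1` this is the Ricci moment identity of cycle 4
(`2∫|Ric|²v = ∫Rv + (1 − τ⁻¹)∫g⁻¹(dR,df)v`); a smooth step `η` localises it to a sublevel set of
`f` (the core) or to its complement (the end). Proof: Green's first identity along the proper
exhaustion `f` (`CarrilloNi2009_shrinkerLSI.integral_mul_dalembertian_eq_neg_integral_innerDual_of_proper`,
`∫ u Δw = −∫ g⁻¹(du, dw)`) with the `C¹` test function `u = η(f) e^{-f/τ}` against `w = R`: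

* `ΔR = g⁻¹(dR, df) + R − 2|Ric|²` (Hamilton; `dalembertian_scalarCurvature_of_soliton`);
* `du = (η′(f) − τ⁻¹ η(f)) e^{-f/τ} df` (chain rule `mvfderiv_real_comp_apply`), so that
  `u ΔR + g⁻¹(du, dR)` is exactly the displayed integrand;
* the provisos `u ΔR`, `g⁻¹(du, dR)`, `u g⁻¹(df, dR) ∈ L¹(dV)` are the weights `|Ric|² v`,
  `g⁻¹(dR, df) v` (Munteanu–Sesum; `ricciNormSq_integrable`, `ricciNormSq_innerDual_integrable`) and
  `R v` (`weightedIntegrability_riemVolume`) times the bounded continuous factors `η(f)`, `η′(f)`;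
* properness of `f` and `R ≥ 0`:
  `NoncompactShrinkerGapCarrilloNiClauses.scalarCurvature_nonneg_and_isCompact_sublevel`.

Everything here is proved; no definition and no named fact is introduced.

## References

* O. Munteanu, J. Wang, *Structure at infinity for shrinking Ricci solitons*, arXiv:1606.01861,
  §2 (p. 6). [MunteanuWang2016]
* O. Munteanu, N. Sesum, J. Geom. Anal. 23 (2013) 539–561, Thm. 1.4 / 1.5. [MunteanuSesum2013]
* [CarrilloNi2009] J. Carrillo, L. Ni, Comm. Anal. Geom. 17 (2009) 721–753, §4.
* Y. Wang, G. Wang (Wang–Wang 2023), arXiv:2308.06560, Prop. 2.6.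
-/

noncomputable section

-- `Summit.SmoothPoincare4.SmoothPoincare4.…` (summit = problem) trips `dupNamespace` on every decl.
set_option linter.dupNamespace false

open scoped Manifold ContDiff ENNReal NNReal Topology
open MeasureTheory Set Filter
open Literature.Geometry.Lorentzian Literature.Geometry.Riemannian

namespace Summit.SmoothPoincare4.SmoothPoincare4.Theorems.ConicalGapSketch

/-! ## The weight `ζ(t) = η(t) e^{-t/τ}` on the real line -/

/-- `ζ(t) = η(t) e^{-t/τ}` has derivative `ζ′(t) = η′(t) e^{-t/τ} + η(t) e^{-t/τ} (−1/τ)` for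
`η` differentiable. -/
theorem secondOrderTest_hasDerivAt_weight {η : ℝ → ℝ} (hη : Differentiable ℝ η) (τ t : ℝ) :
    HasDerivAt (fun s : ℝ ↦ η s * Real.exp (-s / τ))
      (deriv η t * Real.exp (-t / τ) + η t * (Real.exp (-t / τ) * (-1 / τ))) t :=
  (hη t).hasDerivAt.mul (weightedIdentity_hasDerivAt_expNegDiv τ t)

/-! ## The chain rule `d(η(f) e^{-f/τ}) = ζ′(f) df` inside the inverse metric (any dimension) -/

section Pointwise

variable {n : ℕ} {M : Type*} [TopologicalSpace M] [ChartedSpace (EuclideanSpace ℝ (Fin n)) M]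
  [IsManifold (𝓡 n) ∞ M]
  {g : PseudoRiemannianMetric (𝓡 n) ∞ (EuclideanSpace ℝ (Fin n)) (TangentSpace (𝓡 n) : M → Type _)}
  {f : M → ℝ}

/-- `g⁻¹(d(η(f) e^{-f/τ}), dρ) = (η′(f) e^{-f/τ} + η(f) e^{-f/τ} (−1/τ)) g⁻¹(df, dρ)` for `η`
differentiable and `f` differentiable at `x` (chain rule `mvfderiv_real_comp_apply`). -/
theorem secondOrderTest_innerDual_mvfderiv_weight {η : ℝ → ℝ} (hη : Differentiable ℝ η) (τ : ℝ)
    {ρ : M → ℝ} {x : M} (hfx : MDifferentiableAt (𝓡 n) 𝓘(ℝ, ℝ) f x) :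
    g.innerDual x (mvfderiv (𝓡 n) (fun y ↦ η (f y) * Real.exp (-f y / τ)) x).toLinearMap
        (mvfderiv (𝓡 n) ρ x).toLinearMap =
      (deriv η (f x) * Real.exp (-f x / τ) + η (f x) * (Real.exp (-f x / τ) * (-1 / τ))) *
        g.innerDual x (mvfderiv (𝓡 n) f x).toLinearMap (mvfderiv (𝓡 n) ρ x).toLinearMap := by
  have hd := secondOrderTest_hasDerivAt_weight hη τ (f x)
  have hlin : (mvfderiv (𝓡 n) (fun y ↦ η (f y) * Real.exp (-f y / τ)) x).toLinearMap =
      (deriv η (f x) * Real.exp (-f x / τ) + η (f x) * (Real.exp (-f x / τ) * (-1 / τ))) •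
        (mvfderiv (𝓡 n) f x).toLinearMap := by
    ext v
    have := mvfderiv_real_comp_apply (I := 𝓡 n) hd hfx v
    simpa [Function.comp_def] using this
  rw [hlin]
  simp only [PseudoRiemannianMetric.innerDual, LinearMap.smul_apply, smul_eq_mul]

end Pointwise

/-! ## The identity over `g.riemVolume` (any dimension) -/

section ProperGreen

variable {n : ℕ} {M : Type*} [TopologicalSpace M] [ChartedSpace (EuclideanSpace ℝ (Fin n)) M]
  [IsManifold (𝓡 n) ∞ M] [T3Space M] [MeasurableSpace M] [BorelSpace M]
  {g : PseudoRiemannianMetric (𝓡 n) ∞ (EuclideanSpace ℝ (Fin n)) (TangentSpace (𝓡 n) : M → Type _)}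
  {f : M → ℝ} [g.HasLeviCivita]

/-- **The second-order test-function identity over `g.riemVolume`** (any dimension): on a gradient
shrinker `Ric + Hess f = g/2`, `R + |∇f|² = f` with proper potential and `R ≥ 0`, for every
`η ∈ C¹(ℝ)` with `|η|, |η′| ≤ C` and every `τ > 0`, the function
`e^{-f/τ} [ (η′(f) + (1 − τ⁻¹) η(f)) g⁻¹(dR, df) + η(f) (R − 2|Ric|²) ]` is integrable with integral
`0`: it equals `u ΔR + g⁻¹(du, dR)` for `u = η(f) e^{-f/τ}` (Hamilton's identity
`dalembertian_scalarCurvature_of_soliton` and the chain rule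
`secondOrderTest_innerDual_mvfderiv_weight`), and `∫ u ΔR = −∫ g⁻¹(du, dR)` by Green's identity along
the proper exhaustion `f`
(`CarrilloNi2009_shrinkerLSI.integral_mul_dalembertian_eq_neg_integral_innerDual_of_proper`), whose
provisos are `|Ric|² e^{-f/τ}`, `g⁻¹(dR, df) e^{-f/τ}`, `R e^{-f/τ} ∈ L¹` (`ricciNormSq_integrable`,
`ricciNormSq_innerDual_integrable`, `weightedIntegrability_riemVolume`) times bounded continuous
factors (`Integrable.bdd_mul`). -/
theorem secondOrderTestIdentity_riemVolume (hg : g.IsRiemannian)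
    (hf : ContMDiff (𝓡 n) 𝓘(ℝ, ℝ) ∞ f)
    (hsol : ∀ (x : M) (X Y : TangentSpace (𝓡 n) x),
      g.ricci x X Y + g.hessian f x X Y = (1 / 2 : ℝ) * g.val x X Y)
    (hnorm : ∀ x : M, g.scalarCurvature x + g.gradSq f x = f x)
    (hprop : ∀ R : ℝ, IsCompact {x | f x ≤ R}) (hR0 : ∀ x, 0 ≤ g.scalarCurvature x)
    {η : ℝ → ℝ} {C : ℝ} (hη : ContDiff ℝ 1 η) (hb : ∀ r, |η r| ≤ C)
    (hb' : ∀ r, |deriv η r| ≤ C) {τ : ℝ} (hτ : 0 < τ) :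
    Integrable (fun x ↦ Real.exp (-f x / τ) *
        ((deriv η (f x) + (1 - τ⁻¹) * η (f x)) *
          g.innerDual x (mvfderiv (𝓡 n) g.scalarCurvature x).toLinearMap
            (mvfderiv (𝓡 n) f x).toLinearMap +
        η (f x) * (g.scalarCurvature x - 2 * g.normSq x (g.ricci x)))) g.riemVolume ∧
    ∫ x, Real.exp (-f x / τ) *
        ((deriv η (f x) + (1 - τ⁻¹) * η (f x)) *
          g.innerDual x (mvfderiv (𝓡 n) g.scalarCurvature x).toLinearMap
            (mvfderiv (𝓡 n) f x).toLinearMap +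
        η (f x) * (g.scalarCurvature x - 2 * g.normSq x (g.ricci x))) ∂g.riemVolume = 0 := by
  obtain ⟨-, -, iR⟩ := weightedIntegrability_riemVolume hg hf hsol hnorm hprop hR0 hτ
  have iN := ricciNormSq_integrable hg hf hsol hnorm hprop hR0 hτ
  have iX := ricciNormSq_innerDual_integrable hg hf hsol hnorm hprop hR0 hτ
  have hηd : Differentiable ℝ η := hη.differentiable one_ne_zero
  -- notation
  set v : M → ℝ := fun x ↦ Real.exp (-f x / τ) with hv
  set N : M → ℝ := fun x ↦ g.normSq x (g.ricci x) with hN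
  set X : M → ℝ := fun x ↦ g.innerDual x (mvfderiv (𝓡 n) g.scalarCurvature x).toLinearMap
    (mvfderiv (𝓡 n) f x).toLinearMap with hX
  -- the test function `u = η(f) e^{-f/τ}`: `C¹`; `R ∈ C²`
  set u : M → ℝ := fun y ↦ η (f y) * Real.exp (-f y / τ) with hu
  have hf1 : ContMDiff (𝓡 n) 𝓘(ℝ, ℝ) 1 f := hf.of_le ENat.LEInfty.out
  have hu1 : ContMDiff (𝓡 n) 𝓘(ℝ, ℝ) 1 u :=
    (hη.mul (Real.contDiff_exp.comp (contDiff_neg.div_const τ))).comp_contMDiff hf1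
  have hS2 : ContMDiff (𝓡 n) 𝓘(ℝ, ℝ) 2 g.scalarCurvature :=
    (PseudoRiemannianMetric.contMDiff_scalarCurvature g).of_le ENat.LEInfty.out
  -- the bounded continuous factors `η(f)`, `η′(f)`
  have hηc : Continuous fun x ↦ η (f x) := hη.continuous.comp hf.continuous
  have hη'c : Continuous fun x ↦ deriv η (f x) := (hη.continuous_deriv le_rfl).comp hf.continuous
  have hηb : ∀ᵐ x ∂g.riemVolume, ‖η (f x)‖ ≤ C :=
    Eventually.of_forall fun x ↦ by rw [Real.norm_eq_abs]; exact hb _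
  have hη'b : ∀ᵐ x ∂g.riemVolume, ‖deriv η (f x)‖ ≤ C :=
    Eventually.of_forall fun x ↦ by rw [Real.norm_eq_abs]; exact hb' _
  have iX0 : Integrable (fun x ↦ η (f x) * (X x * v x)) g.riemVolume :=
    iX.bdd_mul hηc.aestronglyMeasurable hηb
  have iX1 : Integrable (fun x ↦ deriv η (f x) * (X x * v x)) g.riemVolume :=
    iX.bdd_mul hη'c.aestronglyMeasurable hη'b
  have iS : Integrable (fun x ↦ η (f x) * (X x * v x + g.scalarCurvature x * v x - 2 * (N x * v x)))
      g.riemVolume :=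
    ((iX.add iR).sub (iN.const_mul 2)).bdd_mul hηc.aestronglyMeasurable hηb
  -- pointwise `u ΔR` (Hamilton's identity)
  have hpt1 : ∀ x, u x * g.dalembertian g.scalarCurvature x =
      η (f x) * (X x * v x + g.scalarCurvature x * v x - 2 * (N x * v x)) := fun x ↦ by
    rw [dalembertian_scalarCurvature_of_soliton g hf hsol x]
    simp only [hu, hX, hv, hN]
    ring
  have huΔ : Integrable (fun x ↦ u x * g.dalembertian g.scalarCurvature x) g.riemVolume :=
    iS.congr (Eventually.of_forall fun x ↦ (hpt1 x).symm)
  -- pointwise `g⁻¹(du, dR) = (η′(f) − τ⁻¹ η(f)) g⁻¹(dR, df) e^{-f/τ}` (chain rule, symmetry)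
  have hpt2 : ∀ x, g.innerDual x (mvfderiv (𝓡 n) u x).toLinearMap
      (mvfderiv (𝓡 n) g.scalarCurvature x).toLinearMap =
      deriv η (f x) * (X x * v x) - τ⁻¹ * (η (f x) * (X x * v x)) := fun x ↦ by
    rw [hu, secondOrderTest_innerDual_mvfderiv_weight hηd τ (hf.mdifferentiableAt (by norm_num)),
      g.innerDual_comm x]
    simp only [hX, hv]
    field_simp
    ring
  have hduw : Integrable (fun x ↦ g.innerDual x (mvfderiv (𝓡 n) u x).toLinearMap
      (mvfderiv (𝓡 n) g.scalarCurvature x).toLinearMap) g.riemVolume :=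
    (iX1.sub (iX0.const_mul τ⁻¹)).congr (Eventually.of_forall fun x ↦ (hpt2 x).symm)
  -- pointwise `u g⁻¹(df, dR) = η(f) g⁻¹(dR, df) e^{-f/τ}`
  have hpt3 : ∀ x, u x * g.innerDual x (mvfderiv (𝓡 n) f x).toLinearMap
      (mvfderiv (𝓡 n) g.scalarCurvature x).toLinearMap = η (f x) * (X x * v x) := fun x ↦ by
    rw [g.innerDual_comm x]
    simp only [hu, hX, hv]
    ring
  have hcross : Integrable (fun x ↦ u x * g.innerDual x (mvfderiv (𝓡 n) f x).toLinearMap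
      (mvfderiv (𝓡 n) g.scalarCurvature x).toLinearMap) g.riemVolume :=
    iX0.congr (Eventually.of_forall fun x ↦ (hpt3 x).symm)
  -- Green's identity along the proper exhaustion `f`
  have hG : ∫ x, u x * g.dalembertian g.scalarCurvature x ∂g.riemVolume =
      -∫ x, g.innerDual x (mvfderiv (𝓡 n) u x).toLinearMap
        (mvfderiv (𝓡 n) g.scalarCurvature x).toLinearMap ∂g.riemVolume :=
    CarrilloNi2009_shrinkerLSI.integral_mul_dalembertian_eq_neg_integral_innerDual_of_proper hg hf
      hprop hu1 hS2 huΔ hduw hcross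
  -- the displayed integrand is `u ΔR + g⁻¹(du, dR)`
  have hT : ∀ x, Real.exp (-f x / τ) *
      ((deriv η (f x) + (1 - τ⁻¹) * η (f x)) *
        g.innerDual x (mvfderiv (𝓡 n) g.scalarCurvature x).toLinearMap
          (mvfderiv (𝓡 n) f x).toLinearMap +
      η (f x) * (g.scalarCurvature x - 2 * g.normSq x (g.ricci x))) =
      u x * g.dalembertian g.scalarCurvature x +
        g.innerDual x (mvfderiv (𝓡 n) u x).toLinearMap
          (mvfderiv (𝓡 n) g.scalarCurvature x).toLinearMap := fun x ↦ by
    rw [hpt1, hpt2]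
    simp only [hX, hv, hN]
    ring
  refine ⟨(huΔ.add hduw).congr (Eventually.of_forall fun x ↦ (hT x).symm), ?_⟩
  rw [integral_congr_ae (Eventually.of_forall hT), integral_add huΔ hduw, hG, neg_add_cancel]

end ProperGreen

/-! ## The registered helper (n = 4, crux vocabulary) -/

/-- **Helper `helper_secondOrderTestIdentity` of line `Sketch`** (the second-order Ricci identity in
general test-function form, `n = 4`): on every complete connected normalised 4-d gradient shrinking
Ricci soliton, for every `η ∈ C¹(ℝ)` with `|η|, |η′| ≤ C` and every `τ > 0`,
`∫ e^{-f/τ} [ (η′(f) + (1 − τ⁻¹) η(f)) g⁻¹(dR, df) + η(f) (R − 2|Ric|²) ] dV = 0`, the integrand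
being `dV`-integrable (`dV` the Riemannian measure of `g.toContMDiffRiemannianMetric hg`, to which
`g.riemVolume` unfolds by `riemVolume_eq`): `R ≥ 0` and properness of `f`
(`NoncompactShrinkerGapCarrilloNiClauses.scalarCurvature_nonneg_and_isCompact_sublevel`), then
`secondOrderTestIdentity_riemVolume`. -/
theorem helper_secondOrderTestIdentity : ∀ (M : Type) [TopologicalSpace M] [T2Space M] [SecondCountableTopology M] [ChartedSpace (EuclideanSpace ℝ (Fin 4)) M] [IsManifold (𝓡 4) ∞ M] [ConnectedSpace M] [T3Space M] [MeasurableSpace M] [BorelSpace M] (g : Literature.Geometry.Lorentzian.PseudoRiemannianMetric (𝓡 4) ∞ (EuclideanSpace ℝ (Fin 4)) (TangentSpace (𝓡 4) : M → Type _)) [g.HasLeviCivita] (f : M → ℝ) (hg : g.IsRiemannian), (∀ (x : M) (r : NNReal), IsCompact {y : M | g.edist hg x y ≤ r}) → ContMDiff (𝓡 4) 𝓘(ℝ, ℝ) ∞ f → (∀ (x : M) (X Y : TangentSpace (𝓡 4) x), g.ricci x X Y + g.hessian f x X Y = (1 / 2 : ℝ) * g.val x X Y) → (∀ x : M, g.scalarCurvature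 x + g.gradSq f x = f x) → ∀ (η : ℝ → ℝ) (C : ℝ), ContDiff ℝ 1 η → (∀ r, |η r| ≤ C) → (∀ r, |deriv η r| ≤ C) → ∀ τ : ℝ, 0 < τ → MeasureTheory.Integrable (fun x ↦ Real.exp (-f x / τ) * ((deriv η (f x) + (1 - τ⁻¹) * η (f x)) * g.innerDual x (mvfderiv (𝓡 4) g.scalarCurvature x).toLinearMap (mvfderiv (𝓡 4) f x).toLinearMap + η (f x) * (g.scalarCurvature x - 2 * g.normSq x (g.ricci x)))) (Literature.Geometry.Lorentzian.riemannianMeasure (g.toContMDiffRiemannianMetric hg)) ∧ ∫ x, Real.exp (-f x / τ) * ((deriv η (f x) + (1 - τ⁻¹) * η (f x)) * g.innerDual x (mvfderiv (𝓡 4) g.scalarCurvature x).toLinearMap (mvfderiv (𝓡 4) f x).toLinearMap + η (f x) * (g.scalarCurvature x - 2 * g.normSq x (g.ricci x))) ∂(Literature.Geometry.Lorentzian.riemannianMeasure (g.toContMDiffRiemannianMetric hg)) = 0 := by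
  intro M _ _ _ _ _ _ _ _ _ g _ f hg hc hf hsol hnorm η C hη hb hb' τ hτ
  obtain ⟨hR0, -, hprop⟩ :=
    NoncompactShrinkerGapCarrilloNiClauses.scalarCurvature_nonneg_and_isCompact_sublevel g f hg hc hf
      hsol hnorm
  rw [← PseudoRiemannianMetric.riemVolume_eq hg]
  exact secondOrderTestIdentity_riemVolume hg hf hsol hnorm hprop hR0 hη hb hb' hτ

end Summit.SmoothPoincare4.SmoothPoincare4.Theorems.ConicalGapSketch

end
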